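import Literature.Probability.LatticeModels.LocalPerturbationClusterExpansion
import Literature.Probability.LatticeModels.LocalPerturbationLogZLocality
import Literature.Probability.LatticeModels.LocalPerturbationObservables
import HarnessLib

/-!
# Crux `IR` (stmt-QuantumFields-19354), lane B: far-cell decay in the Kotecký–Preiss regime, part 1∕3 — the observable as one more cell
# (generic over the tree's local-perturbation layer; route-independent, Theses-free)

Helper module for item `stmt-QuantumFields-19354` (`--supports`; it closes nothing), lane `ym-19354-onsetsc-p2` (g2; owner R118 (3) GO).
Part 1 of the three-file proof of the DISTANCE-SENSITIVE Kotecký–Preiss bound `norm_pertExpect_sub_pertExpect_sdiff_le` (part 3,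
`Theorems/IR/BlockedActivityKPDecay`); part 2 (`Theorems/IR/BlockedActivityKPDecayClusters`) is the cluster combinatorics and the
`τ`-weighted pinned bound.

WHY.  The lane's reductions `univShellCond_of_blockedActivityW(_sharp)` (p536391 ∕ p538158) compare the centre expectation under two exterior
data with the FREE reference value (`norm_pertExpect_sub_integral_le'`, `KP.norm_pertExpect_sub_integral_le_sharp`): every cell factor, however
far from the observable, is charged, so the activity radius must be `≤ radiusKP ε = ε ∕ (13448 e²)` with `ε` the accuracy of the onset format —
the distance `2n` between the observable and the cells where the two data differ is never used.

THE DEVICE (this file: «the observable as one more cell»).  For a local perturbation `(μ, R, 𝓕, g, ε)` (tree `IsLocalPerturbation`) and an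
`S`-local observable `F` with `‖F‖ ≤ B`, adjoin ONE cell `∗ = none` to `V` (`Option V`): adjacency `extAdj R S` (`∗` adjacent to the cells
touched by `S`), σ-algebra `extSigma 𝓕 S ∗ = ⨆_{p ∈ S} 𝓕 p`, factor `extFactor g F c ∗ = c · F`.  For `‖c‖ · B ≤ ε` this is again a local
perturbation of radius `ε` (`isLocalPerturbation_ext`; degree `Δ'` with `Δ + 1 ≤ Δ'`, `(Δ+1)·#S ≤ Δ'`, `card_extNbr_le`), and
  `⟨F⟩_C = c⁻¹ · (Z'(C ∪ {∗}) ∕ Z'(C) − 1)`            (`pertExpect_eq_ext_ratio`: expand the factor at `∗`),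
  `Z'(C) ∕ Z'(C ∪ {∗}) = exp (−W(C))`                   (`pertZ_ext_div_eq_exp_neg_pinnedSum`: tree `polymerPartitionFunction_sdiff_div_eq_exp`, [KP86, (5)]),
  `⟨F⟩_C = c⁻¹ · (exp W(C) − 1)`                        (`pertExpect_eq_pinnedSum`),
where `W(C) = pinnedSum …` is the sum of the truncated (cluster) weights of the extended polymer gas over the families of polymers inside
`C ∪ {∗}` containing a polymer through `∗`.  So the whole dependence of `⟨F⟩_C` on far cells sits in ONE pinned cluster sum.

presearch: «decay of correlations ∕ boundary influence from the cluster expansion» → [corpus: FriedliVelenik2017 §5.7] (high-temperature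
expansion: analyticity and exponential decay via clusters connecting the supports); [corpus: arxiv-cond-mat_9905434 p.8, Bertini–Cirillo–Olivieri
1999 §2.5; Olivieri 1988 JSP 50; Olivieri–Picco 1990 JSP 59] (finite-size condition ⇒ convergent cluster expansion of the blocked system ⇒
strong mixing — the in-print sibling of the lane, owner R118 (3)); galaxy (`boundary condition|cluster expansion|exponential decay`, star all):
textbook hits only.  The «extra cell» device is folklore (the observable as a decorated polymer, Seiler LNP 159 Ch. 2); no tree lemma states it.

HONEST FRAMING: an abstract expansion estimate; nothing about Yang–Mills; not a gap, not Clay.  No `sorry`; axioms ⊆ {propext,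
Classical.choice, Quot.sound}; no global instances (local `haveI` only), no notation.
Refs: KoteckyPreiss1986 (1), (2), (5); FriedliVelenik2017 §5.7; SeilerLNP1982 Ch. 2; OsterwalderSeilerAnnPhys1978 §3.
-/

set_option autoImplicit false

noncomputable section

open MeasureTheory ProbabilityTheory Finset
open Literature.Probability.LatticeModels

namespace Summit.QuantumFields.YangMills.Cruxes.IR.BlockedActivity.KP

/-! ## §1 The extended cell system: the observable as one more cell -/

section Ext

variable {V : Type*} {Ω : Type*} {mΩ : MeasurableSpace Ω}

/-- Adjacency of the extended cell set `Option V`: old cells as before; the new cell `none` (the observable) is adjacent to the cells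
touched by `S` (in `S` or `R`-adjacent to a cell of `S`); `none` is not adjacent to itself. -/
def extAdj (R : V → V → Prop) (S : Finset V) : Option V → Option V → Prop
  | some p, some q => R p q
  | none, some q => q ∈ S ∨ ∃ w ∈ S, R w q
  | some p, none => p ∈ S ∨ ∃ w ∈ S, R w p
  | none, none => False

/-- The cells of the original system behind an extended cell: `none ↦ S`, `some p ↦ {p}`. -/
def baseCells (S : Finset V) (x : Option V) : Finset V := x.elim S fun p => {p}

/-- The local σ-algebras of the extended system: `extSigma 𝓕 S none = ⨆_{p ∈ S} 𝓕 p`, `extSigma 𝓕 S (some p) = 𝓕 p` (as a `⨆` over `{p}`). -/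
@[reducible] def extSigma (𝓕 : V → MeasurableSpace Ω) (S : Finset V) (x : Option V) : MeasurableSpace Ω := ⨆ p ∈ baseCells S x, 𝓕 p

/-- The cell factors of the extended system: the old factors, and `c · F` at the new cell. -/
def extFactor (g : V → Ω → ℂ) (F : Ω → ℂ) (c : ℂ) : Option V → Ω → ℂ
  | some p => g p
  | none => fun ω => c * F ω

/-- The neighbour lists of the extended system. -/
def extNbr [DecidableEq V] (nbr : V → Finset V) (S : Finset V) : Option V → Finset (Option V)
  | some p => insert none ((nbr p).map Function.Embedding.some)
  | none => (S ∪ S.biUnion nbr).map Function.Embedding.some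

variable {R : V → V → Prop} {S : Finset V}

/-- `extAdj` on two old cells. -/
@[simp] theorem extAdj_some_some (p q : V) : extAdj R S (some p) (some q) ↔ R p q := Iff.rfl
/-- `extAdj` from the new cell. -/
@[simp] theorem extAdj_none_some (q : V) : extAdj R S none (some q) ↔ (q ∈ S ∨ ∃ w ∈ S, R w q) := Iff.rfl
/-- `extAdj` to the new cell. -/
@[simp] theorem extAdj_some_none (p : V) : extAdj R S (some p) none ↔ (p ∈ S ∨ ∃ w ∈ S, R w p) := Iff.rfl
/-- the new cell is not adjacent to itself. -/
@[simp] theorem extAdj_none_none : extAdj R S none none ↔ False := Iff.rfl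
/-- `baseCells S none = S`. -/
@[simp] theorem baseCells_none : baseCells S none = S := rfl
/-- `baseCells S (some p) = {p}`. -/
@[simp] theorem baseCells_some (p : V) : baseCells S (some p) = {p} := rfl

/-- `extAdj` is symmetric when `R` is. -/
theorem extAdj_symm (hR : ∀ x y, R x y → R y x) : ∀ x y, extAdj R S x y → extAdj R S y x := by
  rintro (_ | p) (_ | q) h
  · exact h
  · exact h
  · exact h
  · exact hR _ _ h

variable [DecidableEq V]

/-- neighbours of the new cell. -/
@[simp] theorem extNbr_none (nbr : V → Finset V) : extNbr nbr S none = (S ∪ S.biUnion nbr).map Function.Embedding.some := rfl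
/-- neighbours of an old cell. -/
@[simp] theorem extNbr_some (nbr : V → Finset V) (p : V) :
    extNbr nbr S (some p) = insert none ((nbr p).map Function.Embedding.some) := rfl

/-- Degree of the extended system: `≤ Δ'` whenever `Δ + 1 ≤ Δ'` and `(Δ+1) · #S ≤ Δ'`. -/
theorem card_extNbr_le {nbr : V → Finset V} {Δ Δ' : ℕ} (hΔ : ∀ x, (nbr x).card ≤ Δ)
    (h1 : Δ + 1 ≤ Δ') (h2 : (Δ + 1) * S.card ≤ Δ') : ∀ x, (extNbr nbr S x).card ≤ Δ' := by
  rintro (_ | p)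
  · rw [extNbr_none, card_map]
    calc (S ∪ S.biUnion nbr).card ≤ S.card + (S.biUnion nbr).card := card_union_le _ _
      _ ≤ S.card + ∑ a ∈ S, (nbr a).card := by gcongr; exact card_biUnion_le
      _ ≤ S.card + ∑ _a ∈ S, Δ := by gcongr with a _; exact hΔ a
      _ = (Δ + 1) * S.card := by rw [sum_const, smul_eq_mul]; ring
      _ ≤ Δ' := h2
  · rw [extNbr_some]
    calc (insert none ((nbr p).map Function.Embedding.some)).card ≤ ((nbr p).map Function.Embedding.some).card + 1 :=
          card_insert_le _ _
      _ = (nbr p).card + 1 := by rw [card_map]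
      _ ≤ Δ + 1 := by gcongr; exact hΔ p
      _ ≤ Δ' := h1

/-- The neighbour lists of the extended system contain the `extAdj`-neighbours. -/
theorem mem_extNbr {nbr : V → Finset V} (hnbr : ∀ x y, R x y → y ∈ nbr x) :
    ∀ x y, extAdj R S x y → y ∈ extNbr nbr S x := by
  rintro (_ | p) (_ | q) h
  · exact absurd h id
  · rw [extNbr_none]
    have hq : q ∈ S ∪ S.biUnion nbr := by
      rcases h with h | ⟨w, hw, hwq⟩
      · exact mem_union_left _ h
      · exact mem_union_right _ (mem_biUnion.2 ⟨w, hw, hnbr _ _ hwq⟩)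
    exact mem_map_of_mem Function.Embedding.some hq
  · rw [extNbr_some]; exact mem_insert_self _ _
  · rw [extNbr_some]
    exact mem_insert_of_mem (mem_map_of_mem Function.Embedding.some (hnbr _ _ h))

/-- Touching cell sets of the base system come from touching sets of the extended system. -/
theorem touches_ext_of_touches_base (hR : ∀ x y, R x y → R y x) {K₁ K₂ : Finset (Option V)}
    (h : Touches R (K₁.biUnion (baseCells S)) (K₂.biUnion (baseCells S))) : Touches (extAdj R S) K₁ K₂ := by
  obtain ⟨w, hw, q, hq, hwq⟩ := h
  obtain ⟨x, hx, hwx⟩ := mem_biUnion.1 hw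
  obtain ⟨y, hy, hqy⟩ := mem_biUnion.1 hq
  refine ⟨x, hx, y, hy, ?_⟩
  cases x with
  | none =>
    cases y with
    | none => exact Or.inl rfl
    | some q' =>
      have hq' : q = q' := by simpa [baseCells] using hqy
      subst hq'
      have hwS : w ∈ S := by simpa [baseCells] using hwx
      rcases hwq with rfl | hwq
      · exact Or.inr (Or.inl hwS)
      · exact Or.inr (Or.inr ⟨w, hwS, hwq⟩)
  | some p' =>
    have hp' : w = p' := by simpa [baseCells] using hwx
    subst hp'
    cases y with
    | none =>
      have hqS : q ∈ S := by simpa [baseCells] using hqy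
      rcases hwq with rfl | hwq
      · exact Or.inr (Or.inl hqS)
      · exact Or.inr (Or.inr ⟨q, hqS, hR _ _ hwq⟩)
    | some q' =>
      have hq' : q = q' := by simpa [baseCells] using hqy
      subst hq'
      rcases hwq with rfl | hwq
      · exact Or.inl rfl
      · exact Or.inr hwq

variable {μ : Measure Ω} {𝓕 : V → MeasurableSpace Ω} {g : V → Ω → ℂ} {ε B : ℝ} {F : Ω → ℂ}

/-- **The extended system is a local perturbation of the same radius** (`‖c‖ · B ≤ ε`). -/
theorem isLocalPerturbation_ext (hR : ∀ x y, R x y → R y x) (h : IsLocalPerturbation μ R 𝓕 g ε)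
    (hF : IsLocalObservable 𝓕 F S B) {c : ℂ} (hc : ‖c‖ * B ≤ ε) :
    IsLocalPerturbation μ (extAdj R S) (extSigma 𝓕 S) (extFactor g F c) ε where
  le x := iSup₂_le fun p _ => h.le p
  indep K₁ K₂ hK := by
    have h1 : (⨆ x ∈ K₁, extSigma 𝓕 S x) = ⨆ p ∈ K₁.biUnion (baseCells S), 𝓕 p := by
      rw [Finset.iSup_biUnion]
    have h2 : (⨆ x ∈ K₂, extSigma 𝓕 S x) = ⨆ p ∈ K₂.biUnion (baseCells S), 𝓕 p := by
      rw [Finset.iSup_biUnion]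
    rw [h1, h2]
    exact h.indep _ _ fun ht => hK (touches_ext_of_touches_base hR ht)
  measurable x := by
    cases x with
    | none => exact hF.measurable.const_mul c
    | some p =>
      refine (h.measurable p).mono ?_ le_rfl
      exact le_iSup₂_of_le (f := fun q (_ : q ∈ baseCells S (some p)) => 𝓕 q) p (by simp) le_rfl
  norm_le x ω := by
    cases x with
    | none =>
      show ‖c * F ω‖ ≤ ε
      rw [norm_mul]
      exact (mul_le_mul_of_nonneg_left (hF.norm_le ω) (norm_nonneg _)).trans hc
    | some p => exact h.norm_le p ω
  nonneg := h.nonneg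

/-! ## §2 The observable as a ratio of extended partition functions -/

omit [DecidableEq V] in
/-- The extended factors on the copy `C.map some` of `C` are the old ones. -/
theorem prod_extFactor_map (c : ℂ) (C : Finset V) (ω : Ω) :
    ∏ x ∈ C.map Function.Embedding.some, (1 + extFactor g F c x ω) = ∏ p ∈ C, (1 + g p ω) := by
  rw [prod_map]; rfl

omit [DecidableEq V] in
/-- `Z'(C.map some) = Z(C)`. -/
theorem pertZ_ext_map (c : ℂ) (C : Finset V) :
    pertZ μ (extFactor g F c) (C.map Function.Embedding.some) = pertZ μ g C := by
  unfold pertZ; simp_rw [prod_extFactor_map]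

omit [DecidableEq V] in
/-- `none ∉ C.map some`. -/
theorem none_notMem_map (C : Finset V) : (none : Option V) ∉ C.map Function.Embedding.some := by simp

omit [DecidableEq V] in
/-- `F · ∏_{p ∈ C} (1 + g p)` is integrable on a finite measure space. -/
theorem integrable_obs_mul_prod_one_add [IsFiniteMeasure μ] (h : IsLocalPerturbation μ R 𝓕 g ε)
    (hF : IsLocalObservable 𝓕 F S B) (C : Finset V) : Integrable (fun ω => F ω * ∏ p ∈ C, (1 + g p ω)) μ := by
  refine Integrable.of_bound (((hF.measurable' h).mul (h.measurable_prod_one_add C)).aestronglyMeasurable)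
    (B * (1 + ε) ^ C.card) (Filter.Eventually.of_forall fun ω => ?_)
  rw [norm_mul]
  exact mul_le_mul (hF.norm_le ω) (h.norm_prod_one_add_le C ω) (norm_nonneg _) (hF.nonneg ω)

/-- **`Z'(C.map some ∪ {∗}) = Z(C) + c · N_F(C)`** (expand the factor at the new cell). -/
theorem pertZ_ext_insert [IsFiniteMeasure μ] (h : IsLocalPerturbation μ R 𝓕 g ε) (hF : IsLocalObservable 𝓕 F S B)
    (c : ℂ) (C : Finset V) :
    pertZ μ (extFactor g F c) (insert none (C.map Function.Embedding.some)) = pertZ μ g C + c * pertNum μ g F C := by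
  unfold pertZ pertNum
  have hpt : ∀ ω, ∏ x ∈ insert none (C.map Function.Embedding.some), (1 + extFactor g F c x ω) =
      ∏ p ∈ C, (1 + g p ω) + c * (F ω * ∏ p ∈ C, (1 + g p ω)) := fun ω => by
    rw [prod_insert (none_notMem_map C), prod_extFactor_map]
    show (1 + c * F ω) * _ = _
    ring
  simp_rw [hpt]
  rw [integral_add (h.integrable_prod_one_add C) ((integrable_obs_mul_prod_one_add h hF C).const_mul c),
    integral_const_mul]

/-- **`⟨F⟩_C = c⁻¹ (Z'(C.map some ∪ {∗}) ∕ Z'(C.map some) − 1)`** for `c ≠ 0`, `Z(C) ≠ 0`. -/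
theorem pertExpect_eq_ext_ratio [IsFiniteMeasure μ] (h : IsLocalPerturbation μ R 𝓕 g ε) (hF : IsLocalObservable 𝓕 F S B)
    {c : ℂ} (hc : c ≠ 0) (C : Finset V) (hZ : pertZ μ g C ≠ 0) :
    pertExpect μ g F C = c⁻¹ * (pertZ μ (extFactor g F c) (insert none (C.map Function.Embedding.some)) /
      pertZ μ (extFactor g F c) (C.map Function.Embedding.some) - 1) := by
  rw [pertZ_ext_insert h hF, pertZ_ext_map]
  unfold pertExpect
  field_simp
  ring

/-! ## §3 The cluster form: `Z'(C ∪ {∗}) ∕ Z'(C) = exp W(C)` with `W` the cluster sum pinned at `∗` -/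

open scoped Classical in
/-- **The pinned cluster sum** of the extended polymer gas on the volume `L ⊆ Option V`: the sum of the truncated weights of the families of
`extAdj`-connected subsets of `L` that contain a polymer through the new cell `none`. -/
def pinnedSum (R : V → V → Prop) (S : Finset V) (μ : Measure Ω) (g' : Option V → Ω → ℂ) (L : Finset (Option V)) : ℂ :=
  ∑ 𝒞 ∈ (rconnSubsets (extAdj R S) L).powerset with (∃ X ∈ 𝒞, (none : Option V) ∈ X),
    truncatedWeight (GeomInc (extAdj R S)) (connActivity (extAdj R S) μ g') 𝒞

/-- The polymers of `C.map some` are the polymers of `C.map some ∪ {∗}` avoiding `∗`. -/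
theorem rconnSubsets_map_eq_sdiff (C : Finset V) :
    rconnSubsets (extAdj R S) (C.map Function.Embedding.some) =
      rconnSubsets (extAdj R S) (insert none (C.map Function.Embedding.some)) \
        (rconnSubsets (extAdj R S) (insert none (C.map Function.Embedding.some))).filter fun X => (none : Option V) ∈ X := by
  ext X
  rw [mem_sdiff, mem_filter, mem_rconnSubsets, mem_rconnSubsets]
  constructor
  · rintro ⟨hXC, hconn⟩
    refine ⟨⟨hXC.trans (subset_insert _ _), hconn⟩, fun ⟨_, hnone⟩ => none_notMem_map C (hXC hnone)⟩
  · rintro ⟨⟨hXL, hconn⟩, hnot⟩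
    refine ⟨fun x hx => ?_, hconn⟩
    rcases mem_insert.1 (hXL hx) with rfl | h
    · exact absurd ⟨⟨hXL, hconn⟩, hx⟩ hnot
    · exact h

variable {nbr : V → Finset V} {Δ Δ' : ℕ} {τ : ℝ}

/-- **`Z'(C.map some) ∕ Z'(C.map some ∪ {∗}) = exp (−W(C))`** (tree `polymerPartitionFunction_sdiff_div_eq_exp`, [KP86, (5)], for the
extended polymer gas in the KP regime). -/
theorem pertZ_ext_div_eq_exp_neg_pinnedSum [IsProbabilityMeasure μ] (hR : ∀ x y, R x y → R y x)
    (hΔ : ∀ x, (nbr x).card ≤ Δ) (hnbr : ∀ x y, R x y → y ∈ nbr x) (h1 : Δ + 1 ≤ Δ') (h2 : (Δ + 1) * S.card ≤ Δ')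
    (h : IsLocalPerturbation μ R 𝓕 g ε) (hF : IsLocalObservable 𝓕 F S B) {c : ℂ} (hc : ‖c‖ * B ≤ ε)
    (hsmall : Real.exp 1 * ε * ((Δ' : ℝ) + 1) ^ 2 ≤ 1 / 2) (C : Finset V) :
    pertZ μ (extFactor g F c) (C.map Function.Embedding.some) /
        pertZ μ (extFactor g F c) (insert none (C.map Function.Embedding.some)) =
      Complex.exp (-pinnedSum R S μ (extFactor g F c) (insert none (C.map Function.Embedding.some))) := by
  classical
  haveI : Std.Symm (extAdj R S) := ⟨extAdj_symm hR⟩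
  have h' := isLocalPerturbation_ext hR h hF hc
  have hR' := extAdj_symm (S := S) hR
  set L := insert none (C.map Function.Embedding.some) with hL
  have hKP := isKPVolume_connActivity (card_extNbr_le hΔ h1 h2) (mem_extNbr hnbr) h' hsmall (rconnSubsets (extAdj R S) L)
  have hZL : pertZ μ (extFactor g F c) L =
      polymerPartitionFunction (GeomInc (extAdj R S)) (connActivity (extAdj R S) μ (extFactor g F c)) (rconnSubsets (extAdj R S) L) := by
    rw [pertZ_eq_polymerPartitionFunction hR' h' L,
      ← polymerPartitionFunction_connActivity (𝒜 := rconnSubsets (extAdj R S) L) fun X hX => (mem_rconnSubsets.1 hX).2]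
  have hZC : pertZ μ (extFactor g F c) (C.map Function.Embedding.some) =
      polymerPartitionFunction (GeomInc (extAdj R S)) (connActivity (extAdj R S) μ (extFactor g F c))
        (rconnSubsets (extAdj R S) L \ (rconnSubsets (extAdj R S) L).filter fun X => (none : Option V) ∈ X) := by
    rw [pertZ_eq_polymerPartitionFunction hR' h' _, rconnSubsets_map_eq_sdiff,
      ← polymerPartitionFunction_connActivity
        (𝒜 := rconnSubsets (extAdj R S) L \ (rconnSubsets (extAdj R S) L).filter fun X => (none : Option V) ∈ X)
        fun X hX => (mem_rconnSubsets.1 (mem_sdiff.1 hX).1).2]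
  rw [hZL, hZC, polymerPartitionFunction_sdiff_div_eq_exp hKP]
  have hfilt : (rconnSubsets (extAdj R S) L).powerset.filter
      (fun 𝒞 => (𝒞 ∩ (rconnSubsets (extAdj R S) L).filter fun X => (none : Option V) ∈ X).Nonempty) =
      (rconnSubsets (extAdj R S) L).powerset.filter fun 𝒞 => ∃ X ∈ 𝒞, (none : Option V) ∈ X := by
    refine filter_congr fun 𝒞 h𝒞 => ?_
    have h𝒞' : 𝒞 ⊆ rconnSubsets (extAdj R S) L := mem_powerset.1 h𝒞
    constructor
    · rintro ⟨X, hX⟩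
      rw [mem_inter, mem_filter] at hX
      exact ⟨X, hX.1, hX.2.2⟩
    · rintro ⟨X, hX, hnX⟩
      exact ⟨X, mem_inter.2 ⟨hX, mem_filter.2 ⟨h𝒞' hX, hnX⟩⟩⟩
  rw [hfilt]
  rfl

/-- **`⟨F⟩_C = c⁻¹ (exp W(C) − 1)`**: the perturbed expectation as a pinned cluster sum of the extended system. -/
theorem pertExpect_eq_pinnedSum [IsProbabilityMeasure μ] (hR : ∀ x y, R x y → R y x)
    (hΔ : ∀ x, (nbr x).card ≤ Δ) (hnbr : ∀ x y, R x y → y ∈ nbr x) (h1 : Δ + 1 ≤ Δ') (h2 : (Δ + 1) * S.card ≤ Δ')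
    (h : IsLocalPerturbation μ R 𝓕 g ε) (hF : IsLocalObservable 𝓕 F S B) {c : ℂ} (hc0 : c ≠ 0) (hc : ‖c‖ * B ≤ ε)
    (hsmall : Real.exp 1 * ε * ((Δ' : ℝ) + 1) ^ 2 ≤ 1 / 2) (C : Finset V) :
    pertExpect μ g F C = c⁻¹ * (Complex.exp (pinnedSum R S μ (extFactor g F c) (insert none (C.map Function.Embedding.some))) - 1) := by
  classical
  have h' := isLocalPerturbation_ext hR h hF hc
  have hR' := extAdj_symm (S := S) hR
  have hΔ' := card_extNbr_le (S := S) hΔ h1 h2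
  have hnbr' := mem_extNbr (S := S) hnbr
  -- `Z(C) ≠ 0`: the base system is small too (`Δ + 1 ≤ Δ'`)
  have hsmall0 : Real.exp 1 * ε * ((Δ : ℝ) + 1) ^ 2 ≤ 1 / 2 := by
    have hle : ((Δ : ℝ) + 1) ^ 2 ≤ ((Δ' : ℝ) + 1) ^ 2 := by
      have : (Δ : ℝ) + 1 ≤ (Δ' : ℝ) + 1 := by
        have : ((Δ + 1 : ℕ) : ℝ) ≤ (Δ' : ℝ) := by exact_mod_cast h1
        push_cast at this; linarith
      exact pow_le_pow_left₀ (by positivity) this 2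
    have hε := h.nonneg
    calc Real.exp 1 * ε * ((Δ : ℝ) + 1) ^ 2 ≤ Real.exp 1 * ε * ((Δ' : ℝ) + 1) ^ 2 := by gcongr
      _ ≤ 1 / 2 := hsmall
  have hZ : pertZ μ g C ≠ 0 := pertZ_ne_zero hR hΔ hnbr h hsmall0 C
  have hZ' : pertZ μ (extFactor g F c) (C.map Function.Embedding.some) ≠ 0 := by rwa [pertZ_ext_map]
  have hZL : pertZ μ (extFactor g F c) (insert none (C.map Function.Embedding.some)) ≠ 0 := pertZ_ne_zero hR' hΔ' hnbr' h' hsmall _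
  rw [pertExpect_eq_ext_ratio h hF hc0 C hZ]
  congr 2
  have hexp := pertZ_ext_div_eq_exp_neg_pinnedSum hR hΔ hnbr h1 h2 h hF hc hsmall C
  rw [Complex.exp_neg] at hexp
  rw [← inv_inv (Complex.exp _), ← hexp, inv_div]

end Ext

end Summit.QuantumFields.YangMills.Cruxes.IR.BlockedActivity.KP

end
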